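import Literature.Topology.FourManifolds.CircleSurgery
import Literature.Topology.FourManifolds.CerfGammaFourProofs
import Literature.Topology.FourManifolds.Diffeotopy
import Literature.Topology.FourManifolds.TorusCoordinates
import Literature.Topology.FourManifolds.MappingTorusGlue
import HarnessLib

/-!
# Surgered mapping tori of diffeomorphisms of `T³` (Gompf's `X_φ^ε`, framing-free):
# conjugation, inversion, based-isotopy invariance, and the Dehn twist `δ ≃ Δ`

Second file of the decomposition of the named fact
`Literature.Topology.FourManifolds.nonempty_diffeomorph_sphere_four_of_isCappellShanesonSphereOf` (every Cappell–Shaneson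
sphere of every `Aₘ`, either framing, is `S⁴`; R. Gompf, *More Cappell–Shaneson spheres are
standard*, Algebr. Geom. Topol. 10 (2010) 1665–1681, Examples 3.1(a)) along the architecture of
Gompf's proof. Gompf (§2) works with the mapping torus `X_φ` of a diffeomorphism `φ` of a 3-manifold
`M` and the manifolds `X_φ^ε` obtained by surgery on the section circle through a fixed point `p`;
his main tool, Theorem 2.1, replaces `φ` by `φ ∘ δᵏ` or `δᵏ ∘ φ` for a Dehn twist `δ` along a torus
`T ⊂ M`, and §3 applies it to `M = T³`, `φ = A ∈ SL(3, ℤ)` in standard form, where "`δ` is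
isotopic to the linear diffeomorphism `Δ = !![1, -1, 0; 0, 1, 0; 0, 1, 1]`", so that the pair of
Cappell–Shaneson spheres of `A` agrees with that of `Δᵏ A` and of `A Δᵏ`.

This file supplies, sorry-free, the part of that argument which is *soft* (no fishtail
neighbourhoods, no Kirby calculus):

* `Literature.IsSurgeredMappingTorusOf φ X` — Gompf's `X_φ^ε` for `M = T³`, `p = 1`, with the framing
  `ε` unspecified: the body of the tree's `Literature.IsCappellShanesonSphereOf A X`
  (`CircleSurgery.lean`) with the linear monodromy `torusDiffeomorph A` replaced by an arbitrary
  diffeomorphism `φ` of `T³` (`isCappellShanesonSphereOf_iff` is `Iff.rfl`).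
* **Invariances, all for the same `X` and the same mapping torus** (only the gluing embeddings of
  the two cylinders `T³ × (0, 1)`, `T³ × (1/2, 3/2)` are changed): conjugation by a based
  diffeomorphism (`IsSurgeredMappingTorusOf.conj`, Gompf §3 "only depends on the conjugacy
  class"), inversion of the monodromy (`IsSurgeredMappingTorusOf.symm`, swap the cylinders and
  reflect time; §3 "inverting `A` preserves `X_φ^ε`" — this also shows that the tree's convention
  `(x, s) ∼ (φ x, s + 1)` and Gompf's `(t, x) ∼ (t - 1, φ x)` give the same predicate), and
  **based-isotopy invariance** (`IsSurgeredMappingTorusOf.trans_of_isDiffeotopicToIdRel`,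
  `isSurgeredMappingTorusOf_congr_of_isDiffeotopicToIdRel`): if `g` is diffeotopic to `id`
  through diffeomorphisms fixing `1` (`Diffeomorph.IsDiffeotopicToIdRel`, defined here on top of
  `Diffeotopy.lean`), then `X_{φ g}^· = X_φ^· = X_{g φ}^·` — re-glue the first cylinder by
  `(x, s) ↦ (F_{λ(s)} x, s)` for a based diffeotopy `F` from `id` to `g` and a plateau function `λ`.
* **Circle maps from lifts** (`Literature.circleMapOfLift g z = e^{i g(arg z)}`, smooth jointly in
  parameters for smooth quasi-periodic lifts — proved with the two charts `arg z`, `arg (-z) + π`),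
  the **twists** `Literature.torusTwist F (z₁, z₂, z₃) = (z₁ (F z₂)⁻¹, z₂, z₃ F z₂)` of `T³` along the tori
  parallel to the one spanned by the first and third coordinate circles, Gompf's **Dehn twist**
  `Literature.torusDehnTwist f k` (twist by the circle map with a degree-`k` lift `f`; for `k = 1` and `f`
  a smooth step this is the `δ` of Theorem 2.1/§3, for `f = k id` it is `Δᵏ`, `torusTwist_zpow`),
  and the **isotopy `δ ≃ Δ` rel base point** (`isDiffeotopicToIdRel_torusDehnTwist_trans_symm`:
  straight-line homotopy of lifts). Consequently (`isSurgeredMappingTorusOf_dehnTwist_trans_iff`,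
  `…_trans_dehnTwist_iff`, and for linear monodromies
  `isSurgeredMappingTorusOf_dehnTwist_trans_torusDiffeomorph_iff`,
  `isSurgeredMappingTorusOf_torusDiffeomorph_trans_dehnTwist_iff`): **in a surgered mapping torus
  the Dehn twist `δ_fᵏ` composed on either side of the monodromy may be replaced by the matrix
  `Δᵏ`** — the step "that is, `δ` is isotopic to the linear diffeomorphism `Δ`. This allows us to
  change `A` (in standard form) by adding any multiple of the second row to the third while
  subtracting the same multiple from the first, or by the conjugate operation on the second
  column" of Gompf §3, given Theorem 2.1.

What is *not* here: Theorem 2.1 itself (`X_{φ∘δᵏ}^ε ≅ X_φ^ε`, fishtail neighbourhoods and Lemma 2.2),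
which together with the results of this file yields the named fact `Literature.Topology.FourManifolds.gompf2010_deltaMove` of
`CappellShanesonProofs.lean`; it is vendored separately.

## References

* R. E. Gompf, *More Cappell–Shaneson spheres are standard*, Algebr. Geom. Topol. 10 (2010)
  1665–1681, doi:10.2140/agt.2010.10.1665 (arXiv:0908.1914): §2 (definition of `X_φ`, `X_φ^ε`, the
  Dehn twist `δ` after Thm 2.1), §3 (conjugacy invariance, inversion, the matrix `Δ`, "`δ` is
  isotopic to `Δ`"). [GompfAGT2010]
* M. W. Hirsch, *Differential Topology*, GTM 33 (1976), Ch. 8 §1 (isotopy, diffeotopy, rel a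
  subset). [HirschDT1976]
-/

open scoped Manifold ContDiff Topology Real
open Set Function

noncomputable section

namespace Literature.Topology.FourManifolds

/-- Local notation: `𝔼 n` is the model Euclidean space `EuclideanSpace ℝ (Fin n)`. -/
local notation "𝔼 " n:arg => EuclideanSpace ℝ (Fin n)

/-- Local notation: `𝕊 n` is the unit sphere in `EuclideanSpace ℝ (Fin (n + 1))`. -/
local notation "𝕊 " n:arg => (Metric.sphere (0 : EuclideanSpace ℝ (Fin (n + 1))) 1)

/-- Local notation: the model with corners `𝓣 = (𝓡 1).prod ((𝓡 1).prod (𝓡 1))` of `ThreeTorus`. -/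
local notation "𝓣" =>
  (ModelWithCorners.prod (𝓡 1) (ModelWithCorners.prod (𝓡 1) (𝓡 1)))

/-! ### The predicate -/

section Predicate

/-- **Surgered mapping torus of a diffeomorphism of `T³`** (Gompf's `X_φ^ε`, with the framing
`ε` left unspecified). For a diffeomorphism `φ` of the 3-torus, `IsSurgeredMappingTorusOf φ X`
says that the 4-manifold `X` (charted on `ℝ⁴`) is obtained from a smooth mapping torus `T` of
`φ` — a closed smooth 4-manifold glued from the cylinders `T³ × (0, 1)` and `T³ × (1/2, 3/2)` by
open embeddings `jA`, `jB` along `mappingTorusRel φ`, `(x, s) ∼ (φ x, s + 1)` — by surgery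
(`IsCircleSurgery`, any tubular neighbourhood, hence either framing) on the *section circle*
through the base point `1 ∈ T³`: a smoothly embedded circle `c : 𝕊¹ → T` with image
`jA ({1} × (0, 1)) ∪ jB ({1} × (1/2, 3/2))` (a circle when `φ 1 = 1`). This is the body of
`Literature.IsCappellShanesonSphereOf A X` with the linear monodromy `torusDiffeomorph A` replaced by an
arbitrary diffeomorphism (`isCappellShanesonSphereOf_iff`), i.e. the construction of Gompf,
*More Cappell–Shaneson spheres are standard*, Algebr. Geom. Topol. 10 (2010), §2, first
paragraph ("Let `X_φ` be the mapping torus `ℝ × M / (t, x) ∼ (t - 1, φ(x))`. Then `ℝ × {p}`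
descends to a circle `C ⊂ X_φ` … let `X_φ^ε` be obtained from `X_φ` by surgery on `C`") for
`M = T³`, `p = 1`, both framings allowed. Convention: the tree's relation `(x, s) ∼ (φ x, s + 1)`
is Gompf's `X_{φ⁻¹}`; by `IsSurgeredMappingTorusOf.symm` (proved below) the predicate is
insensitive to this. [cite: GompfAGT2010, §2 (definition of X_φ and X_φ^ε)] -/
def IsSurgeredMappingTorusOf (φ : ThreeTorus ≃ₘ⟮𝓣, 𝓣⟯ ThreeTorus) (X : Type*)
    [TopologicalSpace X] [ChartedSpace (𝔼 4) X] : Prop :=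
  ∃ (T : Type) (_ : TopologicalSpace T) (_ : T2Space T) (_ : SecondCountableTopology T)
    (_ : CompactSpace T) (_ : ChartedSpace (𝔼 4) T) (_ : IsManifold (𝓡 4) ∞ T)
    (jA : ThreeTorus × ↥mappingTorusPieceOne → T) (jB : ThreeTorus × ↥mappingTorusPieceTwo → T),
    IsOpenGluingWith (ModelWithCorners.prod 𝓣 𝓘(ℝ, ℝ)) (ModelWithCorners.prod 𝓣 𝓘(ℝ, ℝ)) (𝓡 4)
        (mappingTorusRel ⇑φ) jA jB ∧
      ∃ c : 𝕊 1 → T, Manifold.IsSmoothEmbedding (𝓡 1) (𝓡 4) ∞ c ∧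
        Set.range c = jA '' ({1} ×ˢ Set.univ) ∪ jB '' ({1} ×ˢ Set.univ) ∧
        IsCircleSurgery (𝓡 4) (𝓡 4) T X c

/-- **Cappell–Shaneson spheres are the surgered mapping tori of the linear diffeomorphisms**
`torusDiffeomorph A`, `det (A - 1) = ±1` (by definition of both predicates; Gompf 2010, §2: "The
Cappell–Shaneson examples arise when `M` is the 3-torus, so `φ` is obtained from some
`A ∈ SL(3, ℤ)`, and `X_φ^ε` is a homotopy 4-sphere if and only if `det (A - I) = ±1`"). [cite: GompfAGT2010, §2 (definition of X_φ and X_φ^ε)] -/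
theorem isCappellShanesonSphereOf_iff (A : Matrix.SpecialLinearGroup (Fin 3) ℤ) (X : Type*)
    [TopologicalSpace X] [ChartedSpace (𝔼 4) X] :
    IsCappellShanesonSphereOf A X ↔
      ((A.1 - 1).det = 1 ∨ (A.1 - 1).det = -1) ∧
        IsSurgeredMappingTorusOf (torusDiffeomorph A) X :=
  Iff.rfl

/-- A Cappell–Shaneson sphere of `A` is a surgered mapping torus of `torusDiffeomorph A`. [cite: GompfAGT2010, §2 (definition of X_φ and X_φ^ε)] -/
theorem IsCappellShanesonSphereOf.isSurgeredMappingTorusOf {A : Matrix.SpecialLinearGroup (Fin 3) ℤ}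
    {X : Type*} [TopologicalSpace X] [ChartedSpace (𝔼 4) X] (h : IsCappellShanesonSphereOf A X) :
    IsSurgeredMappingTorusOf (torusDiffeomorph A) X :=
  h.2

/-- Conversely, a surgered mapping torus of `torusDiffeomorph A` with `det (A - 1) = ±1` is a
Cappell–Shaneson sphere of `A`. [cite: GompfAGT2010, §2 (definition of X_φ and X_φ^ε)] -/
theorem IsSurgeredMappingTorusOf.isCappellShanesonSphereOf
    {A : Matrix.SpecialLinearGroup (Fin 3) ℤ} {X : Type*} [TopologicalSpace X]
    [ChartedSpace (𝔼 4) X] (h : IsSurgeredMappingTorusOf (torusDiffeomorph A) X)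
    (hA : (A.1 - 1).det = 1 ∨ (A.1 - 1).det = -1) : IsCappellShanesonSphereOf A X :=
  ⟨hA, h⟩

/-- The predicate only depends on the underlying map of the monodromy. [folklore] -/
theorem IsSurgeredMappingTorusOf.congr {φ ψ : ThreeTorus ≃ₘ⟮𝓣, 𝓣⟯ ThreeTorus} {X : Type*}
    [TopologicalSpace X] [ChartedSpace (𝔼 4) X] (h : IsSurgeredMappingTorusOf φ X)
    (hφψ : ∀ x, φ x = ψ x) : IsSurgeredMappingTorusOf ψ X := by
  have : φ = ψ := Diffeomorph.ext hφψ
  exact this ▸ h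

/-- `h.symm.symm = h` pointwise, for diffeomorphisms (definitional; dot-notation extension in
Mathlib's `Diffeomorph` namespace, primed to avoid a future clash). [folklore] -/
@[simp] theorem _root_.Diffeomorph.symm_symm_apply' {E H : Type*} [NormedAddCommGroup E]
    [NormedSpace ℝ E] [TopologicalSpace H] {I : ModelWithCorners ℝ E H} {E' H' : Type*}
    [NormedAddCommGroup E'] [NormedSpace ℝ E'] [TopologicalSpace H'] {I' : ModelWithCorners ℝ E' H'}
    {M : Type*} [TopologicalSpace M] [ChartedSpace H M] {M' : Type*} [TopologicalSpace M']
    [ChartedSpace H' M'] {n : WithTop ℕ∞} (h : M ≃ₘ^n⟮I, I'⟯ M') (x : M) : h.symm.symm x = h x :=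
  rfl

/-- A diffeomorphism fixing a point has inverse fixing that point (deliberate dot-notation extension in
Mathlib's `Diffeomorph` namespace). [folklore] -/
theorem _root_.Diffeomorph.symm_apply_eq_self_of_apply_eq_self {E H : Type*}
    [NormedAddCommGroup E] [NormedSpace ℝ E] [TopologicalSpace H] {I : ModelWithCorners ℝ E H}
    {M : Type*} [TopologicalSpace M] [ChartedSpace H M] {n : WithTop ℕ∞} (h : M ≃ₘ^n⟮I, I⟯ M)
    {x : M} (hx : h x = x) : h.symm x = x := by
  have := congrArg h.symm hx
  rw [Diffeomorph.symm_apply_apply] at this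
  exact this.symm

end Predicate

/-! ### Conjugation invariance -/

section Conj

/-- Transporting the mapping-torus relation through an injection `g` of the fibre conjugates the
monodromy: if `g ∘ ψ = φ ∘ g` then `(g x, s) ∼_φ (g y, t)` iff `(x, s) ∼_ψ (y, t)`. [folklore] -/
theorem mappingTorusRel_prodMap_iff' {M N : Type*} {φ : N → N} {ψ : M → M} {g : M → N}
    (hg : Function.Injective g) (hψ : ∀ x, g (ψ x) = φ (g x))
    (a : M × ↥mappingTorusPieceOne) (b : M × ↥mappingTorusPieceTwo) :
    mappingTorusRel φ (Prod.map g id a) (Prod.map g id b) ↔ mappingTorusRel ψ a b := by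
  simp only [mappingTorusRel, Prod.map_fst, Prod.map_snd, id, ← hψ, hg.eq_iff]

/-- **Conjugation invariance** (Gompf 2010, §3: the pair of Cappell–Shaneson spheres "only
depends on the conjugacy class of `A`"; in general `X_{g⁻¹ φ g} = X_φ`). If `X` is a surgered
mapping torus of `φ` and `g` is a diffeomorphism of `T³` fixing the base point `1`, then `X` is a
surgered mapping torus of `g⁻¹ ∘ φ ∘ g = (g.trans φ).trans g.symm`, for the *same* mapping torus
and section circle: precompose both gluing embeddings with `g × id` on the fibre, which
conjugates the gluing relation (`mappingTorusRel_prodMap_iff'`) and fixes the section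
`{1} × ℝ`; the surgery is untouched. Uses `Manifold.IsSmoothEmbedding.comp_diffeomorph`
(`CerfGammaFourProofs.lean`). [cite: GompfAGT2010, §3 (conjugacy invariance)] -/
theorem IsSurgeredMappingTorusOf.conj {φ : ThreeTorus ≃ₘ⟮𝓣, 𝓣⟯ ThreeTorus} {X : Type*}
    [TopologicalSpace X] [ChartedSpace (𝔼 4) X] (h : IsSurgeredMappingTorusOf φ X)
    (g : ThreeTorus ≃ₘ⟮𝓣, 𝓣⟯ ThreeTorus) (hg : g 1 = 1) :
    IsSurgeredMappingTorusOf ((g.trans φ).trans g.symm) X := by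
  obtain ⟨T, _, _, _, _, _, _, jA, jB, ⟨hA, hAo, hB, hBo, hU, hR⟩, c, hc, hrange, hX⟩ := h
  have h1 : Function.Surjective
      (Prod.map g (id : ↥mappingTorusPieceOne → ↥mappingTorusPieceOne)) :=
    (EquivLike.surjective g).prodMap Function.surjective_id
  have h2 : Function.Surjective
      (Prod.map g (id : ↥mappingTorusPieceTwo → ↥mappingTorusPieceTwo)) :=
    (EquivLike.surjective g).prodMap Function.surjective_id
  have hψ : ∀ x, g (((g.trans φ).trans g.symm) x) = φ (g x) := fun x => by simp
  refine ⟨T, ‹_›, ‹_›, ‹_›, ‹_›, ‹_›, ‹_›, jA ∘ Prod.map g id, jB ∘ Prod.map g id,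
    ⟨?_, ?_, ?_, ?_, ?_, fun a b => ?_⟩, c, hc, ?_, hX⟩
  · have := hA.comp_diffeomorph (g.prodCongr (Diffeomorph.refl 𝓘(ℝ, ℝ) ↥mappingTorusPieceOne ∞))
    simpa only [Diffeomorph.coe_prodCongr, Diffeomorph.coe_refl] using this
  · rwa [h1.range_comp]
  · have := hB.comp_diffeomorph (g.prodCongr (Diffeomorph.refl 𝓘(ℝ, ℝ) ↥mappingTorusPieceTwo ∞))
    simpa only [Diffeomorph.coe_prodCongr, Diffeomorph.coe_refl] using this
  · rwa [h2.range_comp]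
  · rwa [h1.range_comp, h2.range_comp]
  · rw [Function.comp_apply, Function.comp_apply, hR]
    exact mappingTorusRel_prodMap_iff' (EquivLike.injective g) hψ a b
  · rw [hrange, Set.image_comp, Set.image_comp, Set.prodMap_image_prod, Set.prodMap_image_prod,
      Set.image_singleton, Set.image_id, Set.image_id, hg]

/-- Conjugation the other way round: `X_{g φ g⁻¹} = X_φ`. [cite: GompfAGT2010, §3 (conjugacy invariance)] -/
theorem IsSurgeredMappingTorusOf.conj' {φ : ThreeTorus ≃ₘ⟮𝓣, 𝓣⟯ ThreeTorus} {X : Type*}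
    [TopologicalSpace X] [ChartedSpace (𝔼 4) X] (h : IsSurgeredMappingTorusOf φ X)
    (g : ThreeTorus ≃ₘ⟮𝓣, 𝓣⟯ ThreeTorus) (hg : g 1 = 1) :
    IsSurgeredMappingTorusOf ((g.symm.trans φ).trans g) X := by
  exact (h.conj g.symm (g.symm_apply_eq_self_of_apply_eq_self hg)).congr fun x => by simp

/-- The predicates for conjugate monodromies agree. [cite: GompfAGT2010, §3 (conjugacy invariance)] -/
theorem isSurgeredMappingTorusOf_conj_iff {φ : ThreeTorus ≃ₘ⟮𝓣, 𝓣⟯ ThreeTorus} {X : Type*}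
    [TopologicalSpace X] [ChartedSpace (𝔼 4) X] (g : ThreeTorus ≃ₘ⟮𝓣, 𝓣⟯ ThreeTorus)
    (hg : g 1 = 1) :
    IsSurgeredMappingTorusOf ((g.trans φ).trans g.symm) X ↔ IsSurgeredMappingTorusOf φ X := by
  refine ⟨fun h => ?_, fun h => h.conj g hg⟩
  have h' := h.conj' g hg
  refine h'.congr fun x => ?_
  simp

end Conj

/-! ### Inverting the monodromy -/

section Symm

/-- The reflection `s ↦ 3/2 - s` maps `(0, 1)` onto `(1/2, 3/2)`. [folklore] -/
theorem sub_mem_mappingTorusPieceTwo (s : ↥mappingTorusPieceOne) :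
    (3 / 2 : ℝ) - s ∈ mappingTorusPieceTwo := by
  have hs := coe_prop_pieceOne s
  rw [mem_mappingTorusPieceTwo]
  constructor <;> linarith [hs.1, hs.2]

/-- The reflection `t ↦ 3/2 - t` maps `(1/2, 3/2)` onto `(0, 1)`. [folklore] -/
theorem sub_mem_mappingTorusPieceOne (t : ↥mappingTorusPieceTwo) :
    (3 / 2 : ℝ) - t ∈ mappingTorusPieceOne := by
  have ht := coe_prop_pieceTwo t
  rw [mem_mappingTorusPieceOne]
  constructor <;> linarith [ht.1, ht.2]

/-- **The reflection `s ↦ 3/2 - s` as a diffeomorphism `(0, 1) ≅ (1/2, 3/2)`** of the time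
intervals of the two cylinders (it swaps the two layers of the mapping torus). [folklore] -/
def mappingTorusPieceFlip : ↥mappingTorusPieceOne ≃ₘ⟮𝓘(ℝ, ℝ), 𝓘(ℝ, ℝ)⟯ ↥mappingTorusPieceTwo where
  toFun s := ⟨3 / 2 - s, sub_mem_mappingTorusPieceTwo s⟩
  invFun t := ⟨3 / 2 - t, sub_mem_mappingTorusPieceOne t⟩
  left_inv s := Subtype.ext (by simp)
  right_inv t := Subtype.ext (by simp)
  contMDiff_toFun := by
    rw [← ContMDiff.subtypeVal_comp_iff]
    exact (contDiff_const.sub contDiff_id).contMDiff.comp contMDiff_subtype_val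
  contMDiff_invFun := by
    rw [← ContMDiff.subtypeVal_comp_iff]
    exact (contDiff_const.sub contDiff_id).contMDiff.comp contMDiff_subtype_val

/-- The value of the flip. [folklore] -/
@[simp] theorem coe_mappingTorusPieceFlip (s : ↥mappingTorusPieceOne) :
    ((mappingTorusPieceFlip s : ↥mappingTorusPieceTwo) : ℝ) = 3 / 2 - s := rfl

/-- The value of the inverse flip. [folklore] -/
@[simp] theorem coe_mappingTorusPieceFlip_symm (t : ↥mappingTorusPieceTwo) :
    ((mappingTorusPieceFlip.symm t : ↥mappingTorusPieceOne) : ℝ) = 3 / 2 - t := rfl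

/-- **Swapping the layers inverts the monodromy.** Under `(x, s) ↦ (x, 3/2 - s)` on both
cylinders (with the cylinders exchanged), the relation `mappingTorusRel φ` becomes
`mappingTorusRel φ⁻¹`: `(y, 3/2 - t) ∼_φ (x, 3/2 - s)` iff `(x, s) ∼_{φ⁻¹} (y, t)`. [folklore] -/
theorem mappingTorusRel_flip_iff (φ : ThreeTorus ≃ₘ⟮𝓣, 𝓣⟯ ThreeTorus)
    (a : ThreeTorus × ↥mappingTorusPieceOne) (b : ThreeTorus × ↥mappingTorusPieceTwo) :
    mappingTorusRel ⇑φ (b.1, mappingTorusPieceFlip.symm b.2) (a.1, mappingTorusPieceFlip a.2) ↔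
      mappingTorusRel ⇑φ.symm a b := by
  simp only [mappingTorusRel, coe_mappingTorusPieceFlip, coe_mappingTorusPieceFlip_symm]
  constructor
  · rintro (⟨h1, h2⟩ | ⟨h1, h2⟩)
    · exact Or.inl ⟨by linarith, h2.symm⟩
    · refine Or.inr ⟨by linarith, ?_⟩
      rw [h2, Diffeomorph.symm_apply_apply]
  · rintro (⟨h1, h2⟩ | ⟨h1, h2⟩)
    · exact Or.inl ⟨by linarith, h2.symm⟩
    · refine Or.inr ⟨by linarith, ?_⟩
      rw [h2, Diffeomorph.apply_symm_apply]

/-- **Inverting the monodromy does not change the surgered mapping torus** (Gompf 2010, §3: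
"inverting `A` preserves `X_φ^ε`"; in general `X_{φ⁻¹} ≅ X_φ` by reversing time). In the sharp
form: the *same* `X` and the same mapping torus `T` witness `IsSurgeredMappingTorusOf φ.symm X`,
with the two cylinders exchanged and their time coordinates reflected by `s ↦ 3/2 - s`
(`mappingTorusPieceFlip`); the section `{1} × ℝ` is preserved. In particular the tree's
convention `(x, s) ∼ (φ x, s + 1)` for mapping tori and Gompf's `(t, x) ∼ (t - 1, φ x)` (which is
the tree's relation for `φ⁻¹`) give the same predicate. [cite: GompfAGT2010, §3 (inverting A preserves X_φ^ε)] -/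
theorem IsSurgeredMappingTorusOf.symm {φ : ThreeTorus ≃ₘ⟮𝓣, 𝓣⟯ ThreeTorus} {X : Type*}
    [TopologicalSpace X] [ChartedSpace (𝔼 4) X] (h : IsSurgeredMappingTorusOf φ X) :
    IsSurgeredMappingTorusOf φ.symm X := by
  obtain ⟨T, _, _, _, _, _, _, jA, jB, ⟨hA, hAo, hB, hBo, hU, hR⟩, c, hc, hrange, hX⟩ := h
  set eA := (Diffeomorph.refl 𝓣 ThreeTorus ∞).prodCongr mappingTorusPieceFlip with heA
  set eB := (Diffeomorph.refl 𝓣 ThreeTorus ∞).prodCongr mappingTorusPieceFlip.symm with heB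
  have hsA : Function.Surjective eA := eA.surjective
  have hsB : Function.Surjective eB := eB.surjective
  refine ⟨T, ‹_›, ‹_›, ‹_›, ‹_›, ‹_›, ‹_›, jB ∘ eA, jA ∘ eB,
    ⟨hB.comp_diffeomorph eA, ?_, hA.comp_diffeomorph eB, ?_, ?_, fun a b => ?_⟩, c, hc, ?_, hX⟩
  · rwa [hsA.range_comp]
  · rwa [hsB.range_comp]
  · rwa [hsA.range_comp, hsB.range_comp, Set.union_comm]
  · rw [Function.comp_apply, Function.comp_apply, eq_comm, hR, heA, heB,
      Diffeomorph.coe_prodCongr, Diffeomorph.coe_prodCongr, Prod.map_apply, Prod.map_apply,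
      Diffeomorph.coe_refl, id, id]
    exact mappingTorusRel_flip_iff φ a b
  · have hA1 : eB '' ({1} ×ˢ univ) = {1} ×ˢ univ := by
      rw [heB, Diffeomorph.coe_prodCongr, Set.prodMap_image_prod, Diffeomorph.coe_refl,
        Set.image_id, Set.image_univ, (EquivLike.surjective mappingTorusPieceFlip.symm).range_eq]
    have hB1 : eA '' ({1} ×ˢ univ) = {1} ×ˢ univ := by
      rw [heA, Diffeomorph.coe_prodCongr, Set.prodMap_image_prod, Diffeomorph.coe_refl,
        Set.image_id, Set.image_univ, (EquivLike.surjective mappingTorusPieceFlip).range_eq]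
    rw [hrange, Set.image_comp, Set.image_comp, hA1, hB1, Set.union_comm]

/-- `IsSurgeredMappingTorusOf` is invariant under inverting the monodromy. [cite: GompfAGT2010, §3 (inverting A preserves X_φ^ε)] -/
theorem isSurgeredMappingTorusOf_symm_iff {φ : ThreeTorus ≃ₘ⟮𝓣, 𝓣⟯ ThreeTorus} {X : Type*}
    [TopologicalSpace X] [ChartedSpace (𝔼 4) X] :
    IsSurgeredMappingTorusOf φ.symm X ↔ IsSurgeredMappingTorusOf φ X :=
  ⟨fun h => h.symm.congr fun x => by simp, fun h => h.symm⟩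

end Symm


/-! ### Based diffeotopies -/

section Based

variable {EN HN : Type*} [NormedAddCommGroup EN] [NormedSpace ℝ EN] [TopologicalSpace HN]
  {J : ModelWithCorners ℝ EN HN} {N : Type*} [TopologicalSpace N] [ChartedSpace HN N]

/-- **Conjugating a diffeotopy** by a diffeomorphism `h`: the diffeotopy with stages
`h⁻¹ ∘ F_t ∘ h` (conjugate the track by `id × h`). [folklore] -/
def Diffeotopy.conj (D : Diffeotopy J N) (h : N ≃ₘ⟮J, J⟯ N) : Diffeotopy J N where
  track := ((Diffeomorph.refl 𝓘(ℝ, ℝ) ℝ ∞).prodCongr h).trans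
    (D.track.trans ((Diffeomorph.refl 𝓘(ℝ, ℝ) ℝ ∞).prodCongr h.symm))
  track_fst p := by
    show (D.track (p.1, h p.2)).1 = p.1
    exact D.track_fst _
  track_zero x := by
    show h.symm (D.track (0, h x)).2 = x
    rw [D.track_zero, Diffeomorph.symm_apply_apply]

/-- Stages of the conjugated diffeotopy. [folklore] -/
@[simp] theorem Diffeotopy.conj_toFun (D : Diffeotopy J N) (h : N ≃ₘ⟮J, J⟯ N) (t : ℝ) (x : N) :
    (D.conj h).toFun t x = h.symm (D.toFun t (h x)) :=
  rfl

/-- A self-diffeomorphism `φ` of `N` is **diffeotopic to the identity relative to the base point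
`x₀`** if it is the time-`1` stage of a diffeotopy all of whose stages fix `x₀` (a smooth path from
`id` to `φ` in the group of based diffeomorphisms; Hirsch, *Differential Topology* (1976), Ch. 8
§1, isotopy rel a subset). [cite: HirschDT1976, Ch. 8 §1, p. 178] -/
def Diffeomorph.IsDiffeotopicToIdRel (x₀ : N) (φ : N ≃ₘ⟮J, J⟯ N) : Prop :=
  ∃ D : Diffeotopy J N, (∀ t, D.toFun t x₀ = x₀) ∧ D.stage 1 = φ

/-- A diffeomorphism diffeotopic to the identity rel `x₀` fixes `x₀`. [folklore] -/
theorem Diffeomorph.IsDiffeotopicToIdRel.apply_eq {x₀ : N} {φ : N ≃ₘ⟮J, J⟯ N}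
    (hφ : Diffeomorph.IsDiffeotopicToIdRel x₀ φ) : φ x₀ = x₀ := by
  obtain ⟨D, hD, rfl⟩ := hφ
  exact hD 1

/-- Forgetting the base point. [folklore] -/
theorem Diffeomorph.IsDiffeotopicToIdRel.isDiffeotopicToId {x₀ : N} {φ : N ≃ₘ⟮J, J⟯ N}
    (hφ : Diffeomorph.IsDiffeotopicToIdRel x₀ φ) : Diffeomorph.IsDiffeotopicToId φ := by
  obtain ⟨D, -, rfl⟩ := hφ
  exact ⟨D, rfl⟩

/-- The identity is diffeotopic to the identity rel any point. [folklore] -/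
theorem Diffeomorph.isDiffeotopicToIdRel_refl (x₀ : N) :
    Diffeomorph.IsDiffeotopicToIdRel x₀ (Diffeomorph.refl J N ∞) :=
  ⟨Diffeotopy.refl J N, fun _ => rfl, Diffeomorph.ext fun _ => rfl⟩

/-- Based diffeotopy classes are closed under composition (compose the paths stagewise). [folklore] -/
theorem Diffeomorph.IsDiffeotopicToIdRel.trans {x₀ : N} {φ ψ : N ≃ₘ⟮J, J⟯ N}
    (hφ : Diffeomorph.IsDiffeotopicToIdRel x₀ φ) (hψ : Diffeomorph.IsDiffeotopicToIdRel x₀ ψ) :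
    Diffeomorph.IsDiffeotopicToIdRel x₀ (φ.trans ψ) := by
  obtain ⟨D, hD, rfl⟩ := hφ
  obtain ⟨D', hD', rfl⟩ := hψ
  exact ⟨D.trans D', fun t => by simp [hD t, hD' t], Diffeomorph.ext fun x => by simp⟩

/-- Based diffeotopy classes are closed under inversion (invert the path stagewise). [folklore] -/
theorem Diffeomorph.IsDiffeotopicToIdRel.symm {x₀ : N} {φ : N ≃ₘ⟮J, J⟯ N}
    (hφ : Diffeomorph.IsDiffeotopicToIdRel x₀ φ) : Diffeomorph.IsDiffeotopicToIdRel x₀ φ.symm := by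
  obtain ⟨D, hD, rfl⟩ := hφ
  refine ⟨D.inv, fun t => ?_, Diffeomorph.ext fun x => by simp⟩
  rw [Diffeotopy.inv_toFun]
  conv_lhs => rw [← hD t]
  exact D.invFun_toFun t x₀

/-- **Based diffeotopy classes are invariant under conjugation by based diffeomorphisms**
(conjugate the path): if `φ` is diffeotopic to `id` rel `x₀` and `h x₀ = x₀` then so is
`h⁻¹ ∘ φ ∘ h = (h.trans φ).trans h.symm`. [folklore] -/
theorem Diffeomorph.IsDiffeotopicToIdRel.conj {x₀ : N} {φ : N ≃ₘ⟮J, J⟯ N}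
    (hφ : Diffeomorph.IsDiffeotopicToIdRel x₀ φ) (h : N ≃ₘ⟮J, J⟯ N) (hx : h x₀ = x₀) :
    Diffeomorph.IsDiffeotopicToIdRel x₀ ((h.trans φ).trans h.symm) := by
  obtain ⟨D, hD, rfl⟩ := hφ
  refine ⟨D.conj h, fun t => ?_, Diffeomorph.ext fun x => by simp⟩
  rw [Diffeotopy.conj_toFun, hx, hD t]
  exact h.symm_apply_eq_self_of_apply_eq_self hx

/-- Conjugation the other way: `h ∘ φ ∘ h⁻¹`. [folklore] -/
theorem Diffeomorph.IsDiffeotopicToIdRel.conj' {x₀ : N} {φ : N ≃ₘ⟮J, J⟯ N}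
    (hφ : Diffeomorph.IsDiffeotopicToIdRel x₀ φ) (h : N ≃ₘ⟮J, J⟯ N) (hx : h x₀ = x₀) :
    Diffeomorph.IsDiffeotopicToIdRel x₀ ((h.symm.trans φ).trans h) := by
  have := hφ.conj h.symm (h.symm_apply_eq_self_of_apply_eq_self hx)
  rwa [show ((h.symm.trans φ).trans h.symm.symm) = ((h.symm.trans φ).trans h) from
    Diffeomorph.ext fun x => rfl] at this

end Based

/-! ### Isotopy invariance of surgered mapping tori -/

section Isotopy

/-- The time profile `λ s = smoothTransition (2 - 4 s)`: smooth, `λ = 1` on `(-∞, 1/4]` and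
`λ = 0` on `[1/2, ∞)`. [folklore] -/
def isotopyProfile (s : ℝ) : ℝ := Real.smoothTransition (2 - 4 * s)

/-- The time profile is smooth. [folklore] -/
theorem contDiff_isotopyProfile : ContDiff ℝ ∞ isotopyProfile :=
  Real.smoothTransition.contDiff.comp (contDiff_const.sub (contDiff_const.mul contDiff_id))

/-- `λ s = 1` for `s ≤ 1/4`. [folklore] -/
theorem isotopyProfile_of_le {s : ℝ} (hs : s ≤ 1 / 4) : isotopyProfile s = 1 := by
  unfold isotopyProfile
  exact Real.smoothTransition.one_of_one_le (by linarith)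

/-- `λ s = 0` for `1/2 ≤ s`. [folklore] -/
theorem isotopyProfile_of_ge {s : ℝ} (hs : 1 / 2 ≤ s) : isotopyProfile s = 0 := by
  unfold isotopyProfile
  exact Real.smoothTransition.zero_of_nonpos (by linarith)

variable (φ : ThreeTorus ≃ₘ⟮𝓣, 𝓣⟯ ThreeTorus) (D : Diffeotopy 𝓣 ThreeTorus)

/-- The re-gluing diffeomorphism of the first cylinder `T³ × (0, 1)` attached to a diffeotopy
`F`: `(x, s) ↦ (F_{λ s} x, s)`, i.e. `F_1` near `s = 0` and the identity for `s ≥ 1/2`. [folklore] -/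
def isotopyTwistOne : (ThreeTorus × ↥mappingTorusPieceOne) ≃ₘ⟮ModelWithCorners.prod 𝓣 𝓘(ℝ, ℝ),
    ModelWithCorners.prod 𝓣 𝓘(ℝ, ℝ)⟯ (ThreeTorus × ↥mappingTorusPieceOne) where
  toFun p := (D.toFun (isotopyProfile p.2) p.1, p.2)
  invFun p := (D.invFun (isotopyProfile p.2) p.1, p.2)
  left_inv p := by simp
  right_inv p := by simp
  contMDiff_toFun := by
    refine ContMDiff.prodMk ?_ contMDiff_snd
    have hl : ContMDiff (ModelWithCorners.prod 𝓣 𝓘(ℝ, ℝ)) 𝓘(ℝ, ℝ) ∞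
        fun p : ThreeTorus × ↥mappingTorusPieceOne => isotopyProfile (p.2 : ℝ) :=
      contDiff_isotopyProfile.contMDiff.comp (contMDiff_subtype_val.comp contMDiff_snd)
    exact D.contMDiff_uncurry_toFun.comp (hl.prodMk contMDiff_fst)
  contMDiff_invFun := by
    refine ContMDiff.prodMk ?_ contMDiff_snd
    have hl : ContMDiff (ModelWithCorners.prod 𝓣 𝓘(ℝ, ℝ)) 𝓘(ℝ, ℝ) ∞
        fun p : ThreeTorus × ↥mappingTorusPieceOne => isotopyProfile (p.2 : ℝ) :=
      contDiff_isotopyProfile.contMDiff.comp (contMDiff_subtype_val.comp contMDiff_snd)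
    exact D.contMDiff_uncurry_invFun.comp (hl.prodMk contMDiff_fst)

/-- The re-gluing diffeomorphism of the second cylinder `T³ × (1/2, 3/2)`:
`(y, t) ↦ (φ (F_{λ (t - 1)} (F_1⁻¹ (φ⁻¹ y))), t)`, the identity for `t ≤ 5/4`. [folklore] -/
def isotopyTwistTwo : (ThreeTorus × ↥mappingTorusPieceTwo) ≃ₘ⟮ModelWithCorners.prod 𝓣 𝓘(ℝ, ℝ),
    ModelWithCorners.prod 𝓣 𝓘(ℝ, ℝ)⟯ (ThreeTorus × ↥mappingTorusPieceTwo) where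
  toFun p := (φ (D.toFun (isotopyProfile (p.2 - 1)) (D.invFun 1 (φ.symm p.1))), p.2)
  invFun p := (φ (D.toFun 1 (D.invFun (isotopyProfile (p.2 - 1)) (φ.symm p.1))), p.2)
  left_inv p := by simp
  right_inv p := by simp
  contMDiff_toFun := by
    refine ContMDiff.prodMk ?_ contMDiff_snd
    have hl : ContMDiff (ModelWithCorners.prod 𝓣 𝓘(ℝ, ℝ)) 𝓘(ℝ, ℝ) ∞
        fun p : ThreeTorus × ↥mappingTorusPieceTwo => isotopyProfile ((p.2 : ℝ) - 1) :=
      contDiff_isotopyProfile.contMDiff.comp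
        ((contDiff_id.sub contDiff_const).contMDiff.comp (contMDiff_subtype_val.comp contMDiff_snd))
    have h1 : ContMDiff (ModelWithCorners.prod 𝓣 𝓘(ℝ, ℝ)) 𝓣 ∞
        fun p : ThreeTorus × ↥mappingTorusPieceTwo => D.invFun 1 (φ.symm p.1) :=
      (D.contMDiff_invFun 1).comp (φ.symm.contMDiff.comp contMDiff_fst)
    exact φ.contMDiff.comp (D.contMDiff_uncurry_toFun.comp (hl.prodMk h1))
  contMDiff_invFun := by
    refine ContMDiff.prodMk ?_ contMDiff_snd
    have hl : ContMDiff (ModelWithCorners.prod 𝓣 𝓘(ℝ, ℝ)) 𝓘(ℝ, ℝ) ∞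
        fun p : ThreeTorus × ↥mappingTorusPieceTwo => isotopyProfile ((p.2 : ℝ) - 1) :=
      contDiff_isotopyProfile.contMDiff.comp
        ((contDiff_id.sub contDiff_const).contMDiff.comp (contMDiff_subtype_val.comp contMDiff_snd))
    have h1 : ContMDiff (ModelWithCorners.prod 𝓣 𝓘(ℝ, ℝ)) 𝓣 ∞
        fun p : ThreeTorus × ↥mappingTorusPieceTwo =>
          D.invFun (isotopyProfile ((p.2 : ℝ) - 1)) (φ.symm p.1) :=
      D.contMDiff_uncurry_invFun.comp (hl.prodMk (φ.symm.contMDiff.comp contMDiff_fst))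
    exact φ.contMDiff.comp ((D.contMDiff_toFun 1).comp h1)

/-- The value of the first twist (definitional). [folklore] -/
@[simp] theorem isotopyTwistOne_apply (p : ThreeTorus × ↥mappingTorusPieceOne) :
    isotopyTwistOne D p = (D.toFun (isotopyProfile p.2) p.1, p.2) := rfl

/-- The value of the second twist (definitional). [folklore] -/
@[simp] theorem isotopyTwistTwo_apply (p : ThreeTorus × ↥mappingTorusPieceTwo) :
    isotopyTwistTwo φ D p =
      (φ (D.toFun (isotopyProfile (p.2 - 1)) (D.invFun 1 (φ.symm p.1))), p.2) := rfl

/-- **The re-gluing realises the monodromy `φ ∘ F_1`.** For `a = (x, s)`, `b = (y, t)`: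
`mappingTorusRel φ (Φ_A a) (Φ_B b) ↔ mappingTorusRel (φ ∘ F_1) a b`. On the identically glued
overlap `t = s ∈ (1/2, 1)` both twists are the identity; on the monodromy overlap `t = s + 1`,
`s ∈ (0, 1/2)`, the twists are `F_{λ s}` and `φ F_{λ s} F_1⁻¹ φ⁻¹`, and
`φ F_{λ s} F_1⁻¹ φ⁻¹ y = φ F_{λ s} x ↔ y = φ (F_1 x)`. [folklore] -/
theorem mappingTorusRel_isotopyTwist_iff (a : ThreeTorus × ↥mappingTorusPieceOne)
    (b : ThreeTorus × ↥mappingTorusPieceTwo) :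
    mappingTorusRel ⇑φ (isotopyTwistOne D a) (isotopyTwistTwo φ D b) ↔
      mappingTorusRel ⇑((D.stage 1).trans φ) a b := by
  obtain ⟨x, s⟩ := a
  obtain ⟨y, t⟩ := b
  have hs := coe_prop_pieceOne s
  have ht := coe_prop_pieceTwo t
  simp only [mappingTorusRel, Diffeomorph.coe_trans, Function.comp_apply, Diffeotopy.coe_stage]
  dsimp only [isotopyTwistOne_apply, isotopyTwistTwo_apply]
  constructor
  · rintro (⟨hts, hy⟩ | ⟨hts, hy⟩)
    · refine Or.inl ⟨hts, ?_⟩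
      have h1 : isotopyProfile ((t : ℝ) - 1) = 1 := isotopyProfile_of_le (by linarith [hs.2])
      have h2 : isotopyProfile (s : ℝ) = 0 := isotopyProfile_of_ge (by linarith [ht.1])
      rw [h1, h2, D.toFun_invFun, Diffeomorph.apply_symm_apply, D.toFun_zero, id] at hy
      exact hy
    · refine Or.inr ⟨hts, ?_⟩
      rw [hts, add_sub_cancel_right] at hy
      have hy' := (D.stage (isotopyProfile (s : ℝ))).injective (φ.injective hy)
      rw [← hy', D.toFun_invFun, Diffeomorph.apply_symm_apply]
  · rintro (⟨hts, hy⟩ | ⟨hts, hy⟩)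
    · refine Or.inl ⟨hts, ?_⟩
      have h1 : isotopyProfile ((t : ℝ) - 1) = 1 := isotopyProfile_of_le (by linarith [hs.2])
      have h2 : isotopyProfile (s : ℝ) = 0 := isotopyProfile_of_ge (by linarith [ht.1])
      rw [h1, h2, D.toFun_invFun, Diffeomorph.apply_symm_apply, D.toFun_zero, id]
      exact hy
    · refine Or.inr ⟨hts, ?_⟩
      rw [hts, add_sub_cancel_right, hy, Diffeomorph.symm_apply_apply, D.invFun_toFun]

/-- The first twist preserves the section `{1} × (0, 1)` when the diffeotopy is based at `1`. [folklore] -/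
theorem image_isotopyTwistOne (hD : ∀ t, D.toFun t 1 = 1) :
    isotopyTwistOne D '' ({1} ×ˢ univ) = {1} ×ˢ univ := by
  ext p
  simp only [mem_image, mem_prod, mem_singleton_iff, mem_univ, and_true]
  constructor
  · rintro ⟨q, hq, rfl⟩
    show D.toFun _ q.1 = 1
    rw [hq, hD]
  · intro hp
    exact ⟨p, hp, Prod.ext (show D.toFun _ p.1 = p.1 by rw [hp, hD]) rfl⟩

/-- The second twist preserves the section `{1} × (1/2, 3/2)` when the diffeotopy is based at `1`
and `φ 1 = 1`. [folklore] -/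
theorem image_isotopyTwistTwo (hφ : φ 1 = 1) (hD : ∀ t, D.toFun t 1 = 1) :
    isotopyTwistTwo φ D '' ({1} ×ˢ univ) = {1} ×ˢ univ := by
  have hD' : ∀ t, D.invFun t 1 = 1 := fun t => by
    conv_lhs => rw [← hD t]
    exact D.invFun_toFun t 1
  have hφ' : φ.symm 1 = 1 := φ.symm_apply_eq_self_of_apply_eq_self hφ
  ext p
  simp only [mem_image, mem_prod, mem_singleton_iff, mem_univ, and_true]
  constructor
  · rintro ⟨q, hq, rfl⟩
    show φ (D.toFun _ (D.invFun 1 (φ.symm q.1))) = 1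
    rw [hq, hφ', hD', hD, hφ]
  · intro hp
    exact ⟨p, hp, Prod.ext (show φ (D.toFun _ (D.invFun 1 (φ.symm p.1))) = p.1 by
      rw [hp, hφ', hD', hD, hφ]) rfl⟩

/-- **Isotopy invariance of surgered mapping tori** (Gompf 2010, §2: `X_φ^ε` is unchanged when
`φ` is changed by an isotopy fixing a neighbourhood of `p` — "we may assume `φ` restricts to the
identity in a neighborhood of some point `p`"; §3: the Dehn twist "`δ` is isotopic to the linear
diffeomorphism `Δ`"). If `X` is a surgered mapping torus of `φ` with `φ 1 = 1`, and `g` is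
diffeotopic to the identity through diffeomorphisms fixing `1` (`IsDiffeotopicToIdRel 1`), then
`X` is a surgered mapping torus of `φ ∘ g = g.trans φ`, for the *same* mapping torus `T` and
section circle. Proof: if `F` is the based diffeotopy with `F_1 = g`, precompose the gluing
embedding of the first cylinder with `(x, s) ↦ (F_{λ s} x, s)` (`isotopyTwistOne`; `F_1 = g` for
`s ≤ 1/4`, `id` for `s ≥ 1/2`) and that of the second with
`(y, t) ↦ (φ F_{λ(t-1)} g⁻¹ φ⁻¹ y, t)` (`isotopyTwistTwo`; the identity for `t ≤ 5/4`); the new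
embeddings are glued along `mappingTorusRel (φ ∘ g)` (`mappingTorusRel_isotopyTwist_iff`) and
have the same section circle. [cite: GompfAGT2010, §2 (X_φ^ε depends on φ up to isotopy rel p)] -/
theorem IsSurgeredMappingTorusOf.trans_of_isDiffeotopicToIdRel {X : Type*} [TopologicalSpace X]
    [ChartedSpace (𝔼 4) X] {φ : ThreeTorus ≃ₘ⟮𝓣, 𝓣⟯ ThreeTorus} (h : IsSurgeredMappingTorusOf φ X)
    (hφ : φ 1 = 1) {g : ThreeTorus ≃ₘ⟮𝓣, 𝓣⟯ ThreeTorus}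
    (hg : Diffeomorph.IsDiffeotopicToIdRel 1 g) : IsSurgeredMappingTorusOf (g.trans φ) X := by
  obtain ⟨D, hD, rfl⟩ := hg
  obtain ⟨T, _, _, _, _, _, _, jA, jB, ⟨hA, hAo, hB, hBo, hU, hR⟩, c, hc, hrange, hX⟩ := h
  have hsA : Function.Surjective (isotopyTwistOne D) := (isotopyTwistOne D).surjective
  have hsB : Function.Surjective (isotopyTwistTwo φ D) := (isotopyTwistTwo φ D).surjective
  refine ⟨T, ‹_›, ‹_›, ‹_›, ‹_›, ‹_›, ‹_›, jA ∘ isotopyTwistOne D, jB ∘ isotopyTwistTwo φ D,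
    ⟨hA.comp_diffeomorph _, ?_, hB.comp_diffeomorph _, ?_, ?_, fun a b => ?_⟩, c, hc, ?_, hX⟩
  · rwa [hsA.range_comp]
  · rwa [hsB.range_comp]
  · rwa [hsA.range_comp, hsB.range_comp]
  · rw [Function.comp_apply, Function.comp_apply, hR]
    exact mappingTorusRel_isotopyTwist_iff φ D a b
  · rw [hrange, Set.image_comp, Set.image_comp, image_isotopyTwistOne D hD,
      image_isotopyTwistTwo φ D hφ hD]

/-- Isotopy invariance on the other side: `X` is also a surgered mapping torus of
`g ∘ φ = φ.trans g` (invert, apply `trans_of_isDiffeotopicToIdRel` to `φ⁻¹` and `g⁻¹`, invert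
back). [cite: GompfAGT2010, §2 (X_φ^ε depends on φ up to isotopy rel p)] -/
theorem IsSurgeredMappingTorusOf.trans_of_isDiffeotopicToIdRel' {X : Type*} [TopologicalSpace X]
    [ChartedSpace (𝔼 4) X] {φ : ThreeTorus ≃ₘ⟮𝓣, 𝓣⟯ ThreeTorus} (h : IsSurgeredMappingTorusOf φ X)
    (hφ : φ 1 = 1) {g : ThreeTorus ≃ₘ⟮𝓣, 𝓣⟯ ThreeTorus}
    (hg : Diffeomorph.IsDiffeotopicToIdRel 1 g) : IsSurgeredMappingTorusOf (φ.trans g) X := by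
  have h1 := h.symm.trans_of_isDiffeotopicToIdRel (φ.symm_apply_eq_self_of_apply_eq_self hφ)
    hg.symm
  exact h1.symm.congr fun x => rfl

/-- **Surgered mapping tori only depend on the based diffeotopy class of the monodromy**: if
`φ⁻¹ ∘ ψ` is diffeotopic to the identity rel `1` (and `φ 1 = 1`), the predicates for `φ` and `ψ`
agree. [cite: GompfAGT2010, §2 (X_φ^ε depends on φ up to isotopy rel p)] -/
theorem isSurgeredMappingTorusOf_congr_of_isDiffeotopicToIdRel {X : Type*} [TopologicalSpace X]
    [ChartedSpace (𝔼 4) X] {φ ψ : ThreeTorus ≃ₘ⟮𝓣, 𝓣⟯ ThreeTorus} (hφ : φ 1 = 1)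
    (hg : Diffeomorph.IsDiffeotopicToIdRel 1 (ψ.trans φ.symm)) :
    IsSurgeredMappingTorusOf φ X ↔ IsSurgeredMappingTorusOf ψ X := by
  have hψ : ψ 1 = 1 := by
    have := hg.apply_eq
    rw [Diffeomorph.coe_trans, Function.comp_apply] at this
    simpa [hφ] using congrArg φ this
  constructor
  · intro h
    exact (h.trans_of_isDiffeotopicToIdRel hφ hg).congr fun x => by simp
  · intro h
    refine (h.trans_of_isDiffeotopicToIdRel hψ hg.symm).congr fun x => ?_
    show ψ (ψ.symm (φ x)) = φ x
    rw [Diffeomorph.apply_symm_apply]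

end Isotopy


/-! ### Circle maps from their lifts -/

section Lift

attribute [local instance] finrank_real_complex_fact'

/-- A lift `g : ℝ → ℝ` with `g (θ + 2π) = g θ + 2π k` satisfies `g (θ + m • 2π) = g θ + 2π k m`
for all `m ∈ ℤ`. [folklore] -/
theorem apply_add_int_mul_two_pi {g : ℝ → ℝ} {k : ℤ} (hg : ∀ θ, g (θ + 2 * π) = g θ + 2 * π * k)
    (θ : ℝ) (m : ℤ) : g (θ + m * (2 * π)) = g θ + 2 * π * k * m := by
  have hp : Function.Periodic (fun θ => g θ - k * θ) (2 * π) := fun θ => by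
    simp only [hg]
    ring
  have h : g (θ + m * (2 * π)) - k * (θ + m * (2 * π)) = g θ - k * θ := hp.int_mul m θ
  linear_combination h

/-- **The circle map with a given lift.** For `g : ℝ → ℝ`, `circleMapOfLift g z = e^{i g(arg z)}`;
when `g (θ + 2π) = g θ + 2π k` this is the degree-`k` self-map of the circle covered by `g`
(`circleMapOfLift_exp`). [folklore] -/
def circleMapOfLift (g : ℝ → ℝ) (z : Circle) : Circle :=
  Circle.exp (g (Complex.arg (z : ℂ)))

/-- **`circleMapOfLift g` is covered by `g`**: `F (e^{iθ}) = e^{i g θ}` for a quasi-periodic lift. [folklore] -/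
theorem circleMapOfLift_exp {g : ℝ → ℝ} {k : ℤ} (hg : ∀ θ, g (θ + 2 * π) = g θ + 2 * π * k)
    (θ : ℝ) : circleMapOfLift g (Circle.exp θ) = Circle.exp (g θ) := by
  rw [circleMapOfLift, Circle.coe_exp, Complex.arg_exp_mul_I, toIocMod, zsmul_eq_mul,
    show θ - (toIocDiv Real.two_pi_pos (-π) θ : ℝ) * (2 * π) =
      θ + ((-toIocDiv Real.two_pi_pos (-π) θ : ℤ) : ℝ) * (2 * π) by push_cast; ring,
    apply_add_int_mul_two_pi hg, Circle.exp_eq_exp]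
  exact ⟨k * -toIocDiv Real.two_pi_pos (-π) θ, by push_cast; ring⟩

/-- `circleMapOfLift g 1 = 1` when `g 0 = 0`. [folklore] -/
theorem circleMapOfLift_one {g : ℝ → ℝ} (h0 : g 0 = 0) : circleMapOfLift g 1 = 1 := by
  rw [circleMapOfLift, Circle.coe_one, Complex.arg_one, h0, Circle.exp_zero]

/-- The shifted argument `z ↦ arg (-z) + π` is a second lift of the identity of the circle:
`e^{i (arg (-z) + π)} = z` (it is smooth away from `z = 1`, where `arg` itself jumps). [folklore] -/
theorem circleExp_arg_neg_add_pi (z : Circle) :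
    Circle.exp (Complex.arg (-(z : ℂ)) + π) = z := by
  apply Subtype.ext
  rw [Circle.exp_add, Circle.coe_mul, Circle.coe_exp, Circle.coe_exp]
  have h1 : Complex.exp ((Complex.arg (-(z : ℂ)) : ℂ) * Complex.I) = -(z : ℂ) := by
    have := Complex.norm_mul_exp_arg_mul_I (-(z : ℂ))
    rwa [norm_neg, Circle.norm_coe, Complex.ofReal_one, one_mul] at this
  rw [h1, Complex.exp_pi_mul_I]
  ring

/-- The two lifts give the same circle map: `circleMapOfLift g z = e^{i g (arg (-z) + π)}` for a
quasi-periodic `g` (both `arg z` and `arg (-z) + π` are arguments of `z`). [folklore] -/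
theorem circleMapOfLift_eq_exp_arg_neg {g : ℝ → ℝ} {k : ℤ}
    (hg : ∀ θ, g (θ + 2 * π) = g θ + 2 * π * k) (z : Circle) :
    circleMapOfLift g z = Circle.exp (g (Complex.arg (-(z : ℂ)) + π)) := by
  conv_lhs => rw [← circleExp_arg_neg_add_pi z]
  exact circleMapOfLift_exp hg _

/-- The complex coordinate `Circle → ℂ` is smooth. [folklore] -/
theorem contMDiff_coe_circle : ContMDiff (𝓡 1) 𝓘(ℝ, ℂ) ∞ (fun z : Circle ↦ (z : ℂ)) :=
  contMDiff_coe_sphere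

/-- The argument `Circle → ℝ` is smooth at every `z ≠ -1`. [folklore] -/
theorem contMDiffAt_arg_circle {z : Circle} (hz : (z : ℂ) ∈ Complex.slitPlane) :
    ContMDiffAt (𝓡 1) 𝓘(ℝ, ℝ) ∞ (fun w : Circle ↦ Complex.arg (w : ℂ)) z :=
  (contDiffAt_arg hz).comp_contMDiffAt (f := fun w : Circle ↦ (w : ℂ))
    contMDiff_coe_circle.contMDiffAt

/-- The shifted argument `z ↦ arg (-z) + π` is smooth at every `z ≠ 1`. [folklore] -/
theorem contMDiffAt_arg_neg_circle {z : Circle} (hz : -(z : ℂ) ∈ Complex.slitPlane) :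
    ContMDiffAt (𝓡 1) 𝓘(ℝ, ℝ) ∞ (fun w : Circle ↦ Complex.arg (-(w : ℂ)) + π) z := by
  have h : ContMDiffAt (𝓡 1) 𝓘(ℝ, ℂ) ∞ (fun w : Circle ↦ -(w : ℂ)) z :=
    (contDiff_neg.contDiffAt).comp_contMDiffAt contMDiff_coe_circle.contMDiffAt
  exact ((contDiffAt_arg hz).comp_contMDiffAt (f := fun w : Circle ↦ -(w : ℂ)) h).add
    contMDiffAt_const

/-- On the circle, `z ≠ -1` or `z ≠ 1`: either `z` or `-z` lies in the slit plane. [folklore] -/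
theorem mem_slitPlane_or_neg_mem_slitPlane (z : Circle) :
    (z : ℂ) ∈ Complex.slitPlane ∨ -(z : ℂ) ∈ Complex.slitPlane := by
  by_cases h : (z : ℂ) = -1
  · right
    rw [h, neg_neg]
    exact Complex.one_mem_slitPlane
  · exact Or.inl (mem_slitPlane_of_norm_eq_one (Circle.norm_coe z) h)

/-- **Smooth families of circle maps from smooth families of lifts.** If `Φ : ℝ × ℝ → ℝ` is
`C^∞` and each `Φ t` is a lift of degree `k` (`Φ t (θ + 2π) = Φ t θ + 2π k`), then
`(t, z) ↦ circleMapOfLift (Φ t) z` is `C^∞` on `ℝ × 𝕊¹`: near a point with `z ≠ -1` it is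
`e^{i Φ(t, arg z)}`, near `z ≠ 1` it is `e^{i Φ(t, arg(-z) + π)}` (`circleMapOfLift_eq_exp_arg_neg`). [folklore] -/
theorem contMDiff_circleMapOfLift_uncurry {Φ : ℝ → ℝ → ℝ} {k : ℤ}
    (hΦ : ContDiff ℝ ∞ (uncurry Φ)) (hper : ∀ t θ, Φ t (θ + 2 * π) = Φ t θ + 2 * π * k) :
    ContMDiff (𝓘(ℝ, ℝ).prod (𝓡 1)) (𝓡 1) ∞ fun p : ℝ × Circle ↦ circleMapOfLift (Φ p.1) p.2 := by
  intro p
  rcases mem_slitPlane_or_neg_mem_slitPlane p.2 with hz | hz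
  · have h1 : ContMDiffAt (𝓘(ℝ, ℝ).prod (𝓡 1)) 𝓘(ℝ, ℝ × ℝ) ∞
        (fun q : ℝ × Circle ↦ (q.1, Complex.arg (q.2 : ℂ))) p :=
      contMDiffAt_fst.prodMk_space ((contMDiffAt_arg_circle hz).comp p contMDiffAt_snd)
    exact contMDiff_circleExp.contMDiffAt.comp p (hΦ.contDiffAt.comp_contMDiffAt h1)
  · have heq : (fun p : ℝ × Circle ↦ circleMapOfLift (Φ p.1) p.2) =
        fun p ↦ Circle.exp (Φ p.1 (Complex.arg (-(p.2 : ℂ)) + π)) :=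
      funext fun q ↦ circleMapOfLift_eq_exp_arg_neg (hper q.1) q.2
    rw [heq]
    have h1 : ContMDiffAt (𝓘(ℝ, ℝ).prod (𝓡 1)) 𝓘(ℝ, ℝ × ℝ) ∞
        (fun q : ℝ × Circle ↦ (q.1, Complex.arg (-(q.2 : ℂ)) + π)) p :=
      contMDiffAt_fst.prodMk_space ((contMDiffAt_arg_neg_circle hz).comp p contMDiffAt_snd)
    exact contMDiff_circleExp.contMDiffAt.comp p (hΦ.contDiffAt.comp_contMDiffAt h1)

/-- **The circle map of a smooth quasi-periodic lift is smooth.** [folklore] -/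
theorem contMDiff_circleMapOfLift {g : ℝ → ℝ} {k : ℤ} (hg : ContDiff ℝ ∞ g)
    (hper : ∀ θ, g (θ + 2 * π) = g θ + 2 * π * k) :
    ContMDiff (𝓡 1) (𝓡 1) ∞ (circleMapOfLift g) := by
  have h := contMDiff_circleMapOfLift_uncurry (Φ := fun _ θ ↦ g θ) (k := k)
    (hg.comp contDiff_snd) (fun _ θ ↦ hper θ)
  exact h.comp (contMDiff_const.prodMk contMDiff_id : ContMDiff (𝓡 1) (𝓘(ℝ, ℝ).prod (𝓡 1)) ∞
    fun z : Circle ↦ ((0 : ℝ), z))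

/-- Lifts add: `circleMapOfLift (g + h) = circleMapOfLift g * circleMapOfLift h` pointwise. [folklore] -/
theorem circleMapOfLift_add (g h : ℝ → ℝ) (z : Circle) :
    circleMapOfLift (fun θ ↦ g θ + h θ) z = circleMapOfLift g z * circleMapOfLift h z := by
  simp [circleMapOfLift, Circle.exp_add]

/-- The linear lift `θ ↦ k θ` gives the power map `z ↦ z ^ k`. [folklore] -/
theorem circleMapOfLift_int_mul (k : ℤ) (z : Circle) :
    circleMapOfLift (fun θ ↦ k * θ) z = z ^ k := by
  rw [circleMapOfLift, ← circleExp_zpow, Circle.exp_arg]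

/-- The zero lift gives the constant map `1`. [folklore] -/
theorem circleMapOfLift_zero (z : Circle) : circleMapOfLift (fun _ ↦ (0 : ℝ)) z = 1 := by
  simp [circleMapOfLift]

end Lift

/-! ### Dehn twists of `T³` along the torus spanned by the first and third coordinate circles -/

section DehnTwist

attribute [local instance] finrank_real_complex_fact'

/-- **Twisting `T³` along the 2-tori parallel to the one spanned by the first and third coordinate
circles.** For a self-map `F` of the circle, `torusTwist F (z₁, z₂, z₃) = (z₁ · (F z₂)⁻¹, z₂,
z₃ · F z₂)`: each torus `{z₂ = w}` is translated by `F w` in the direction `e₃ - e₁`. For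
`F = circleMapOfLift f` with `f` a lift of degree `1` that is constant outside a short arc this is
Gompf's Dehn twist `δ` of `T³` "along the torus spanned by the first and third coordinate axes, in
the direction of `A v - v = [-1 0 1]ᵀ`" (a collar `I × S¹ × S¹` of that torus, `δ = (Dehn twist) ×
id`); for `F z = z ^ k` it is the linear diffeomorphism `Δ ^ k` (`torusTwist_zpow`; Gompf, *More
Cappell–Shaneson spheres are standard*, Algebr. Geom. Topol. 10 (2010), §2 after Thm 2.1 and §3). [cite: GompfAGT2010, §3 (the Dehn twist δ and the matrix Δ)] -/
def torusTwist (F : Circle → Circle) (z : ThreeTorus) : ThreeTorus :=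
  (z.1 * (F z.2.1)⁻¹, z.2.1, z.2.2 * F z.2.1)

/-- First coordinate of a twist. [folklore] -/
@[simp] theorem torusTwist_fst (F : Circle → Circle) (z : ThreeTorus) :
    (torusTwist F z).1 = z.1 * (F z.2.1)⁻¹ := rfl

/-- Second coordinate of a twist (unchanged). [folklore] -/
@[simp] theorem torusTwist_snd_fst (F : Circle → Circle) (z : ThreeTorus) :
    (torusTwist F z).2.1 = z.2.1 := rfl

/-- Third coordinate of a twist. [folklore] -/
@[simp] theorem torusTwist_snd_snd (F : Circle → Circle) (z : ThreeTorus) :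
    (torusTwist F z).2.2 = z.2.2 * F z.2.1 := rfl

/-- **Twists compose by multiplying their circle maps** (the twists form an abelian group,
the image of `C^∞(S¹, S¹)`). [folklore] -/
theorem torusTwist_torusTwist (F G : Circle → Circle) (z : ThreeTorus) :
    torusTwist F (torusTwist G z) = torusTwist (fun w ↦ F w * G w) z := by
  obtain ⟨a, b, c⟩ := z
  simp only [torusTwist, mul_inv_rev, mul_assoc, mul_comm (G b) (F b)]

/-- The twist by the constant map `1` is the identity. [folklore] -/
theorem torusTwist_one : torusTwist (fun _ ↦ (1 : Circle)) = id := by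
  funext z
  simp [torusTwist]

/-- A twist by a based circle map fixes the base point `1 ∈ T³`. [folklore] -/
theorem torusTwist_apply_one {F : Circle → Circle} (hF : F 1 = 1) : torusTwist F 1 = 1 := by
  simp [torusTwist, hF]

/-- Twists by smooth circle maps are smooth. [folklore] -/
theorem contMDiff_torusTwist {F : Circle → Circle} (hF : ContMDiff (𝓡 1) (𝓡 1) ∞ F) :
    ContMDiff 𝓣 𝓣 ∞ (torusTwist F) := by
  have h2 : ContMDiff 𝓣 (𝓡 1) ∞ fun z : ThreeTorus ↦ F z.2.1 :=
    hF.comp (contMDiff_fst.comp contMDiff_snd)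
  exact (contMDiff_fst.mul h2.inv).prodMk
    ((contMDiff_fst.comp contMDiff_snd).prodMk ((contMDiff_snd.comp contMDiff_snd).mul h2))

/-- Smooth families of circle maps give jointly smooth families of twists. [folklore] -/
theorem contMDiff_torusTwist_uncurry {Φ : ℝ → Circle → Circle}
    (hΦ : ContMDiff (𝓘(ℝ, ℝ).prod (𝓡 1)) (𝓡 1) ∞ fun p : ℝ × Circle ↦ Φ p.1 p.2) :
    ContMDiff (𝓘(ℝ, ℝ).prod 𝓣) 𝓣 ∞ fun p : ℝ × ThreeTorus ↦ torusTwist (Φ p.1) p.2 := by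
  have h2 : ContMDiff (𝓘(ℝ, ℝ).prod 𝓣) (𝓡 1) ∞ fun p : ℝ × ThreeTorus ↦ Φ p.1 p.2.2.1 :=
    hΦ.comp (contMDiff_fst.prodMk (contMDiff_fst.comp (contMDiff_snd.comp contMDiff_snd)))
  exact ((contMDiff_fst.comp contMDiff_snd).mul h2.inv).prodMk
    ((contMDiff_fst.comp (contMDiff_snd.comp contMDiff_snd)).prodMk
      ((contMDiff_snd.comp (contMDiff_snd.comp contMDiff_snd)).mul h2))

/-- **The linear twists are the powers of Gompf's `Δ`**: the twist by `z ↦ z ^ k` is the linear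
diffeomorphism `torusMap !![1, -k, 0; 0, 1, 0; 0, k, 1]` of `T³`, i.e. `Δ ^ k` for
`Δ = !![1, -1, 0; 0, 1, 0; 0, 1, 1]` ("adding `k` times the second row to the third while
subtracting the same multiple from the first"; Gompf 2010, §3). [cite: GompfAGT2010, §3 (the matrix Δ)] -/
theorem torusTwist_zpow (k : ℤ) :
    torusTwist (fun w ↦ w ^ k) = torusMap !![1, -k, 0; 0, 1, 0; 0, k, 1] := by
  funext z
  apply torusCoord_injective
  funext i
  rw [torusCoord_torusMap]
  fin_cases i <;> simp [torusMonomial, Fin.prod_univ_three, mul_comm]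

/-- **The twist by a smooth circle map as a diffeomorphism of `T³`**, with inverse the twist by
the pointwise inverse map. [folklore] -/
def torusTwistDiffeo (F : Circle → Circle) (hF : ContMDiff (𝓡 1) (𝓡 1) ∞ F) :
    ThreeTorus ≃ₘ⟮𝓣, 𝓣⟯ ThreeTorus where
  toFun := torusTwist F
  invFun := torusTwist fun w ↦ (F w)⁻¹
  left_inv z := by
    rw [torusTwist_torusTwist]
    simp [torusTwist]
  right_inv z := by
    rw [torusTwist_torusTwist]
    simp [torusTwist]
  contMDiff_toFun := contMDiff_torusTwist hF
  contMDiff_invFun := contMDiff_torusTwist (F := fun w ↦ (F w)⁻¹) hF.inv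

/-- The underlying map of `torusTwistDiffeo F hF`. [folklore] -/
@[simp] theorem coe_torusTwistDiffeo (F : Circle → Circle) (hF : ContMDiff (𝓡 1) (𝓡 1) ∞ F) :
    ⇑(torusTwistDiffeo F hF) = torusTwist F := rfl

/-- The underlying map of the inverse of `torusTwistDiffeo F hF`. [folklore] -/
@[simp] theorem coe_torusTwistDiffeo_symm (F : Circle → Circle)
    (hF : ContMDiff (𝓡 1) (𝓡 1) ∞ F) :
    ⇑(torusTwistDiffeo F hF).symm = torusTwist fun w ↦ (F w)⁻¹ := rfl

/-- **The straight-line diffeotopy of twists.** For a smooth `2π`-periodic `h : ℝ → ℝ`, the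
family `t ↦ torusTwist (circleMapOfLift (t • h))` — twist by the circle maps with the homotopic
lifts `t h` — is a diffeotopy of `T³` from the identity (`t = 0`) to
`torusTwist (circleMapOfLift h)` (`t = 1`); it is jointly smooth by
`contMDiff_circleMapOfLift_uncurry`. [folklore] -/
def torusTwistDiffeotopy (h : ℝ → ℝ) (hh : ContDiff ℝ ∞ h) (hper : ∀ θ, h (θ + 2 * π) = h θ) :
    Diffeotopy 𝓣 ThreeTorus :=
  have hΦ : ContDiff ℝ ∞ (uncurry fun (t θ : ℝ) ↦ t * h θ) :=
    contDiff_fst.mul (hh.comp contDiff_snd)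
  have hΦper : ∀ t θ : ℝ, t * h (θ + 2 * π) = t * h θ + 2 * π * ((0 : ℤ) : ℝ) := fun t θ ↦ by
    rw [hper]; push_cast; ring
  have hsm : ContMDiff (𝓘(ℝ, ℝ).prod (𝓡 1)) (𝓡 1) ∞
      fun p : ℝ × Circle ↦ circleMapOfLift (fun θ ↦ p.1 * h θ) p.2 :=
    contMDiff_circleMapOfLift_uncurry (Φ := fun t θ ↦ t * h θ) hΦ hΦper
  Diffeotopy.mk' 𝓣 (fun t ↦ torusTwist (circleMapOfLift fun θ ↦ t * h θ))
    (fun t ↦ torusTwist fun w ↦ (circleMapOfLift (fun θ ↦ t * h θ) w)⁻¹)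
    (contMDiff_torusTwist_uncurry (Φ := fun t w ↦ circleMapOfLift (fun θ ↦ t * h θ) w) hsm)
    (contMDiff_torusTwist_uncurry (Φ := fun t w ↦ (circleMapOfLift (fun θ ↦ t * h θ) w)⁻¹)
      hsm.inv)
    (fun t z ↦ by rw [torusTwist_torusTwist]; simp [torusTwist])
    (fun t z ↦ by rw [torusTwist_torusTwist]; simp [torusTwist])
    (by
      have h1 : (circleMapOfLift fun θ ↦ (0 : ℝ) * h θ) = fun _ ↦ 1 :=
        funext fun w ↦ by simp only [zero_mul]; exact circleMapOfLift_zero w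
      rw [h1, torusTwist_one])

/-- Stages of the straight-line diffeotopy of twists. [folklore] -/
@[simp] theorem torusTwistDiffeotopy_toFun (h : ℝ → ℝ) (hh : ContDiff ℝ ∞ h)
    (hper : ∀ θ, h (θ + 2 * π) = h θ) (t : ℝ) :
    (torusTwistDiffeotopy h hh hper).toFun t = torusTwist (circleMapOfLift fun θ ↦ t * h θ) :=
  rfl

/-- **Twists with `2π`-periodic lift vanishing at `0` are diffeotopic to the identity rel the
base point**: all stages `torusTwist (circleMapOfLift (t h))` fix `1` since `t h 0 = 0`
(the isotopy underlying Gompf's "`δ` is isotopic to the linear diffeomorphism `Δ`", §3). [cite: GompfAGT2010, §3 (δ is isotopic to Δ)] -/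
theorem isDiffeotopicToIdRel_torusTwistDiffeo {h : ℝ → ℝ} (hh : ContDiff ℝ ∞ h)
    (hper : ∀ θ, h (θ + 2 * π) = h θ) (h0 : h 0 = 0)
    (hF : ContMDiff (𝓡 1) (𝓡 1) ∞ (circleMapOfLift h)) :
    Diffeomorph.IsDiffeotopicToIdRel 1 (torusTwistDiffeo (circleMapOfLift h) hF) := by
  refine ⟨torusTwistDiffeotopy h hh hper, fun t ↦ ?_, Diffeomorph.ext fun z ↦ ?_⟩
  · rw [torusTwistDiffeotopy_toFun]
    exact torusTwist_apply_one (circleMapOfLift_one (by simp [h0]))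
  · show (torusTwistDiffeotopy h hh hper).toFun 1 z = torusTwist (circleMapOfLift h) z
    rw [torusTwistDiffeotopy_toFun]
    simp only [one_mul]

/-- **Gompf's Dehn twist `δᵏ` of `T³` with a prescribed lift.** For a smooth lift `f : ℝ → ℝ`
of degree `k` (`f (θ + 2π) = f θ + 2π k`), `torusDehnTwist f k` is the diffeomorphism
`(z₁, z₂, z₃) ↦ (z₁ e^{-i f(arg z₂)}, z₂, z₃ e^{i f(arg z₂)})` of `T³`. When `k = 1` and `f`
increases from `0` to `2π` across a short arc `[a, b] ⊂ (0, π)` of values of `arg z₂` and is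
constant elsewhere, this is precisely the Dehn twist `δ` of Gompf 2010, Thm 2.1/§3 for `M = T³`:
`(Dehn twist) × id` on the collar `{arg z₂ ∈ [a, b]} ≅ I × S¹ × S¹` of the torus `{z₂ = 1}`
spanned by the first and third coordinate circles, in the direction `A v - v = e₃ - e₁`, with the
base point `1` (where `arg z₂ = 0`) outside its support; general `f` of degree `k` give all
diffeomorphisms based-isotopic to `δᵏ` of this form, in particular `Δᵏ` for `f θ = k θ`. [cite: GompfAGT2010, §2 (definition of δ after Thm 2.1) and §3] -/
def torusDehnTwist (f : ℝ → ℝ) (k : ℤ) (hf : ContDiff ℝ ∞ f)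
    (hper : ∀ θ, f (θ + 2 * π) = f θ + 2 * π * k) : ThreeTorus ≃ₘ⟮𝓣, 𝓣⟯ ThreeTorus :=
  torusTwistDiffeo (circleMapOfLift f) (contMDiff_circleMapOfLift hf hper)

/-- The underlying map of `torusDehnTwist f k`. [folklore] -/
@[simp] theorem coe_torusDehnTwist (f : ℝ → ℝ) (k : ℤ) (hf : ContDiff ℝ ∞ f)
    (hper : ∀ θ, f (θ + 2 * π) = f θ + 2 * π * k) :
    ⇑(torusDehnTwist f k hf hper) = torusTwist (circleMapOfLift f) := rfl

/-- `torusDehnTwist f k` fixes the base point when `f 0 = 0`. [folklore] -/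
theorem torusDehnTwist_apply_one {f : ℝ → ℝ} {k : ℤ} (hf : ContDiff ℝ ∞ f)
    (hper : ∀ θ, f (θ + 2 * π) = f θ + 2 * π * k) (h0 : f 0 = 0) :
    torusDehnTwist f k hf hper 1 = 1 :=
  torusTwist_apply_one (circleMapOfLift_one h0)

/-- **Splitting off the linear part of a lift**: `e^{i f(arg z)} = e^{i (f - k id)(arg z)} · z ^ k`,
where `f - k id` is `2π`-periodic when `f` has degree `k`. [folklore] -/
theorem circleMapOfLift_eq_mul_zpow (f : ℝ → ℝ) (k : ℤ) (w : Circle) :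
    circleMapOfLift f w = circleMapOfLift (fun θ ↦ f θ - k * θ) w * w ^ k := by
  rw [← circleMapOfLift_int_mul, ← circleMapOfLift_add]
  simp only [sub_add_cancel]

/-- The periodic part `f - k id` of a degree-`k` lift is `2π`-periodic. [folklore] -/
theorem periodic_sub_int_mul {f : ℝ → ℝ} {k : ℤ} (hper : ∀ θ, f (θ + 2 * π) = f θ + 2 * π * k)
    (θ : ℝ) : f (θ + 2 * π) - k * (θ + 2 * π) = f θ - k * θ := by
  rw [hper]; ring

/-- **`δ_f = (periodic twist) ∘ Δᵏ`.** If `P ∈ SL(3, ℤ)` acts on `T³` as the linear twist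
`z ↦ torusTwist (· ^ k) z` (i.e. `P = Δ ^ k`, `torusTwist_zpow`), then the Dehn twist with a
degree-`k` lift `f` is `torusDiffeomorph P` followed by the twist with the periodic lift
`f - k id`. [cite: GompfAGT2010, §3 (δ is isotopic to Δ)] -/
theorem torusDehnTwist_eq_trans {f : ℝ → ℝ} {k : ℤ} (hf : ContDiff ℝ ∞ f)
    (hper : ∀ θ, f (θ + 2 * π) = f θ + 2 * π * k) {P : Matrix.SpecialLinearGroup (Fin 3) ℤ}
    (hP : ⇑(torusDiffeomorph P) = torusTwist fun w ↦ w ^ k)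
    (hF : ContMDiff (𝓡 1) (𝓡 1) ∞ (circleMapOfLift fun θ ↦ f θ - k * θ)) :
    torusDehnTwist f k hf hper =
      (torusDiffeomorph P).trans (torusTwistDiffeo (circleMapOfLift fun θ ↦ f θ - k * θ) hF) := by
  refine Diffeomorph.ext fun z ↦ ?_
  rw [Diffeomorph.coe_trans, Function.comp_apply, hP, coe_torusTwistDiffeo, torusTwist_torusTwist,
    coe_torusDehnTwist]
  congr 1
  funext w
  exact circleMapOfLift_eq_mul_zpow f k w

/-- The periodic part of a smooth degree-`k` lift gives a smooth circle map. [folklore] -/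
theorem contMDiff_circleMapOfLift_sub_int_mul {f : ℝ → ℝ} {k : ℤ} (hf : ContDiff ℝ ∞ f)
    (hper : ∀ θ, f (θ + 2 * π) = f θ + 2 * π * k) :
    ContMDiff (𝓡 1) (𝓡 1) ∞ (circleMapOfLift fun θ ↦ f θ - k * θ) :=
  contMDiff_circleMapOfLift (k := 0) (hf.sub (contDiff_const.mul contDiff_id)) fun θ ↦ by
    rw [periodic_sub_int_mul hper]; push_cast; ring

/-- **`Δ⁻ᵏ ∘ δ_f` is diffeotopic to the identity rel the base point** (Gompf 2010, §3: "`δ` is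
isotopic to the linear diffeomorphism `Δ`"; here with base points: `P⁻¹ ∘ δ_f = P⁻¹ ∘ τ ∘ P` for
the periodic twist `τ`, which is based-isotopic to `id` by the straight-line isotopy of lifts). [cite: GompfAGT2010, §3 (δ is isotopic to Δ)] -/
theorem isDiffeotopicToIdRel_torusDehnTwist_trans_symm {f : ℝ → ℝ} {k : ℤ} (hf : ContDiff ℝ ∞ f)
    (hper : ∀ θ, f (θ + 2 * π) = f θ + 2 * π * k) (h0 : f 0 = 0)
    {P : Matrix.SpecialLinearGroup (Fin 3) ℤ} (hP : ⇑(torusDiffeomorph P) = torusTwist fun w ↦ w ^ k) :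
    Diffeomorph.IsDiffeotopicToIdRel 1
      ((torusDehnTwist f k hf hper).trans (torusDiffeomorph P).symm) := by
  have hF := contMDiff_circleMapOfLift_sub_int_mul hf hper
  have hτ : Diffeomorph.IsDiffeotopicToIdRel 1
      (torusTwistDiffeo (circleMapOfLift fun θ ↦ f θ - k * θ) hF) :=
    isDiffeotopicToIdRel_torusTwistDiffeo (hf.sub (contDiff_const.mul contDiff_id))
      (periodic_sub_int_mul hper) (by simp [h0]) hF
  have := hτ.conj (torusDiffeomorph P) (torusDiffeomorph_apply_one P)
  rwa [← torusDehnTwist_eq_trans hf hper hP hF] at this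

/-- **Dehn twists may be replaced by `Δᵏ` in surgered mapping tori (precomposition).** For a
monodromy `φ` fixing `1`, a smooth degree-`k` lift `f` with `f 0 = 0`, and `P ∈ SL(3, ℤ)` acting as
the linear twist `z ↦ z ^ k` on the second coordinate (`P = Δᵏ`): `X` is a surgered mapping torus
of `φ ∘ δ_f` iff it is one of `φ ∘ P` — by the based-isotopy invariance
`isSurgeredMappingTorusOf_congr_of_isDiffeotopicToIdRel` and
`isDiffeotopicToIdRel_torusDehnTwist_trans_symm` (Gompf 2010, §3: Theorem 2.1 "allows us to
compose `A` with a Dehn twist `δ` … that is, `δ` is isotopic to the linear diffeomorphism `Δ`"). [cite: GompfAGT2010, §3 (δ is isotopic to Δ)] -/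
theorem isSurgeredMappingTorusOf_dehnTwist_trans_iff {X : Type*} [TopologicalSpace X]
    [ChartedSpace (𝔼 4) X] (φ : ThreeTorus ≃ₘ⟮𝓣, 𝓣⟯ ThreeTorus) (hφ : φ 1 = 1) {f : ℝ → ℝ}
    {k : ℤ} (hf : ContDiff ℝ ∞ f) (hper : ∀ θ, f (θ + 2 * π) = f θ + 2 * π * k) (h0 : f 0 = 0)
    {P : Matrix.SpecialLinearGroup (Fin 3) ℤ} (hP : ⇑(torusDiffeomorph P) = torusTwist fun w ↦ w ^ k) :
    IsSurgeredMappingTorusOf ((torusDehnTwist f k hf hper).trans φ) X ↔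
      IsSurgeredMappingTorusOf ((torusDiffeomorph P).trans φ) X := by
  symm
  refine isSurgeredMappingTorusOf_congr_of_isDiffeotopicToIdRel (by simp [hφ]) ?_
  have h := isDiffeotopicToIdRel_torusDehnTwist_trans_symm hf hper h0 hP
  rwa [show ((torusDehnTwist f k hf hper).trans φ).trans ((torusDiffeomorph P).trans φ).symm =
      (torusDehnTwist f k hf hper).trans (torusDiffeomorph P).symm from
    Diffeomorph.ext fun z ↦ by simp]

/-- **Dehn twists may be replaced by `Δᵏ` in surgered mapping tori (postcomposition)**: `X` is a
surgered mapping torus of `δ_f ∘ φ` iff it is one of `P ∘ φ` (conjugate the based isotopy by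
`P ∘ φ`). [cite: GompfAGT2010, §3 (δ is isotopic to Δ)] -/
theorem isSurgeredMappingTorusOf_trans_dehnTwist_iff {X : Type*} [TopologicalSpace X]
    [ChartedSpace (𝔼 4) X] (φ : ThreeTorus ≃ₘ⟮𝓣, 𝓣⟯ ThreeTorus) (hφ : φ 1 = 1) {f : ℝ → ℝ}
    {k : ℤ} (hf : ContDiff ℝ ∞ f) (hper : ∀ θ, f (θ + 2 * π) = f θ + 2 * π * k) (h0 : f 0 = 0)
    {P : Matrix.SpecialLinearGroup (Fin 3) ℤ} (hP : ⇑(torusDiffeomorph P) = torusTwist fun w ↦ w ^ k) :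
    IsSurgeredMappingTorusOf (φ.trans (torusDehnTwist f k hf hper)) X ↔
      IsSurgeredMappingTorusOf (φ.trans (torusDiffeomorph P)) X := by
  symm
  refine isSurgeredMappingTorusOf_congr_of_isDiffeotopicToIdRel (by simp [hφ]) ?_
  have hF := contMDiff_circleMapOfLift_sub_int_mul hf hper
  have hτ : Diffeomorph.IsDiffeotopicToIdRel 1
      (torusTwistDiffeo (circleMapOfLift fun θ ↦ f θ - k * θ) hF) :=
    isDiffeotopicToIdRel_torusTwistDiffeo (hf.sub (contDiff_const.mul contDiff_id))
      (periodic_sub_int_mul hper) (by simp [h0]) hF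
  have h := hτ.conj (φ.trans (torusDiffeomorph P)) (by simp [hφ])
  rwa [show ((φ.trans (torusDiffeomorph P)).trans
        (torusTwistDiffeo (circleMapOfLift fun θ ↦ f θ - ↑k * θ) hF)).trans
        (φ.trans (torusDiffeomorph P)).symm =
      (φ.trans (torusDehnTwist f k hf hper)).trans (φ.trans (torusDiffeomorph P)).symm from
    Diffeomorph.ext fun z ↦ by simp [torusDehnTwist_eq_trans hf hper hP hF]] at h

/-- `torusDiffeomorph` is multiplicative: `torusDiffeomorph (A * B) = torusDiffeomorph A ∘
torusDiffeomorph B`. [folklore] -/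
theorem torusDiffeomorph_mul (A B : Matrix.SpecialLinearGroup (Fin 3) ℤ) :
    torusDiffeomorph (A * B) = (torusDiffeomorph B).trans (torusDiffeomorph A) :=
  Diffeomorph.ext fun z ↦ by simp [torusMap_mul]

/-- **Δ-moves on the right**: for `A, P ∈ SL(3, ℤ)` with `P` acting as the linear twist
`z ↦ z ^ k` (`P = Δᵏ`), `X` is a surgered mapping torus of `A ∘ δ_f` iff it is one of the linear
monodromy `A P` (Gompf 2010, §3). [cite: GompfAGT2010, §3 (δ is isotopic to Δ)] -/
theorem isSurgeredMappingTorusOf_dehnTwist_trans_torusDiffeomorph_iff {X : Type*}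
    [TopologicalSpace X] [ChartedSpace (𝔼 4) X] (A : Matrix.SpecialLinearGroup (Fin 3) ℤ)
    {f : ℝ → ℝ} {k : ℤ} (hf : ContDiff ℝ ∞ f) (hper : ∀ θ, f (θ + 2 * π) = f θ + 2 * π * k)
    (h0 : f 0 = 0) {P : Matrix.SpecialLinearGroup (Fin 3) ℤ}
    (hP : ⇑(torusDiffeomorph P) = torusTwist fun w ↦ w ^ k) :
    IsSurgeredMappingTorusOf ((torusDehnTwist f k hf hper).trans (torusDiffeomorph A)) X ↔
      IsSurgeredMappingTorusOf (torusDiffeomorph (A * P)) X := by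
  rw [torusDiffeomorph_mul]
  exact isSurgeredMappingTorusOf_dehnTwist_trans_iff _ (torusDiffeomorph_apply_one A) hf hper h0 hP

/-- **Δ-moves on the left**: `X` is a surgered mapping torus of `δ_f ∘ A` iff it is one of
`P A` (Gompf 2010, §3). [cite: GompfAGT2010, §3 (δ is isotopic to Δ)] -/
theorem isSurgeredMappingTorusOf_torusDiffeomorph_trans_dehnTwist_iff {X : Type*}
    [TopologicalSpace X] [ChartedSpace (𝔼 4) X] (A : Matrix.SpecialLinearGroup (Fin 3) ℤ)
    {f : ℝ → ℝ} {k : ℤ} (hf : ContDiff ℝ ∞ f) (hper : ∀ θ, f (θ + 2 * π) = f θ + 2 * π * k)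
    (h0 : f 0 = 0) {P : Matrix.SpecialLinearGroup (Fin 3) ℤ}
    (hP : ⇑(torusDiffeomorph P) = torusTwist fun w ↦ w ^ k) :
    IsSurgeredMappingTorusOf ((torusDiffeomorph A).trans (torusDehnTwist f k hf hper)) X ↔
      IsSurgeredMappingTorusOf (torusDiffeomorph (P * A)) X := by
  rw [torusDiffeomorph_mul]
  exact isSurgeredMappingTorusOf_trans_dehnTwist_iff _ (torusDiffeomorph_apply_one A) hf hper h0 hP

end DehnTwist

end Literature.Topology.FourManifolds
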